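import Summits.QuantumAdvantage.QuantumAdvantage.Theorems.CharDialTransferDialN
import Literature.Computability.MetaComplexity.RobustHegedusLemma
import HarnessLib

/-!
# CharDial ▸ CountDial, part A — the counting objects: `degBool`, `ExpCountTwoOdd` (EC), B ⟹ EC, EC ⟹ orbit bound

Cell decomp-qadv, lens 6 «barrier-complement carving», generation 24 («CountDial», NODE-g24.md), RESIDUAL MODE beneath
route-QuantumAdvantage-CharDial item stmt-QuantumAdvantage-32599 `FrobLiftOdd`, under the located leaf `TransferDial.FewTypesTwoOdd`
(≡ piece B `StructureLawTwoOdd` modulo the field core PF, parts C/E of `CharDialTransferDial*`).  THE DIAL is the NUMBER of low-degree cuts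
`B_d(m) := #{f : {0,1}^m → {0,1} : deg_𝔽ₚ f ≤ d}` (`degBool`); the piece `ExpCountTwoOdd` (EC) says `B_{2p−3}(m) ≤ C(p)^{m+1}` — WEAKER than B
(`expCount_of_structureLaw`, this file), UNDECIDED with a decidable model sequence (p = 3: census K54/K57), and false one degree up (part B).
This part: `degBool`, `ExpCountAt`, `ExpCountTwoOdd`; ★ `expCount_of_structureLaw : StructureLawTwoOdd → ExpCountTwoOdd` (count the pairs
(Λ, F)); `orbitS` (the coordinate-permutes of a cut), `OrbitBoundAt`, `orbitBound_of_expCount` (EC ⟹ every cut has ≤ C^{m+1} permutes).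

Kernel standard: no placeholders; axioms [propext, Classical.choice, Quot.sound] only (guards at the end); closed computations by kernel `decide`.
-/

set_option autoImplicit false
set_option linter.dupNamespace false

namespace Summit.QuantumAdvantage.QuantumAdvantage.Theorems.CountDial

open Classical
open Finset
open Summit.QuantumAdvantage.AdviceFreeQNC0
open Literature.Computability.MetaComplexity Literature.Computability.MetaComplexity.Smolensky
open Summit.QuantumAdvantage.QuantumAdvantage.Theorems.TransferDial

/-! ## §1 The counting objects (typed) -/

section Count
variable (p : ℕ) [hp : Fact p.Prime]

/-- `B_d(m)` as a finite set: the Boolean functions on `m` bits of `𝔽_p`-degree `≤ d` (the Boolean points of `lowDeg 𝔽_p m d`). -/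
noncomputable def degBool (m d : ℕ) : Finset ((Fin m → Bool) → Bool) := univ.filter fun f => HasDegF p f d

/-- EXPONENTIAL COUNT at degree `d` with base `C`: `B_d(m) ≤ C^{m+1}` for every `m` (the `+1` absorbs `m = 0`). -/
def ExpCountAt (d C : ℕ) : Prop := ∀ m : ℕ, (degBool p m d).card ≤ C ^ (m + 1)

end Count

/-- ★ PIECE EC — `ExpCountTwoOdd` (WEAKER: implied by B, `expCount_of_structureLaw`; UNDECIDED-with-test: census K54 p = 3 model, ratios
`M_m/M_{m−1}` = 5.6–6.9 for m = 8…10; ATTACKABLE by counting): for every prime `p ≥ 5` the number of Boolean functions on `m` bits of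
`𝔽_p`-degree `≤ 2p − 3` is at most `C(p)^{m+1}`. -/
def ExpCountTwoOdd : Prop := ∀ (p : ℕ) [Fact p.Prime], 5 ≤ p → ∃ C : ℕ, ExpCountAt p (2 * p - 3) C

/-! ## §2 B ⟹ EC (kernel): EC is a consequence of the target -/

section BtoEC
variable {p : ℕ} [hp : Fact p.Prime]

/-- The parametrisation `(Λ, F) ↦ F ∘ Λ` of the functions of `K` linear forms. -/
def ofPair {m K : ℕ} (q : (Fin K → Fin m → ZMod p) × ((Fin K → ZMod p) → Bool)) : (Fin m → Bool) → Bool :=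
  fun u => q.2 (fun j => ∑ i, if u i = true then q.1 j i else 0)

/-- Pointwise: if every degree-≤ d cut is a function of `K` forms then `B_d(m) ≤ (p^K · 2^{p^K})^{m+1}`. -/
theorem card_degBool_le_of_forms {d K : ℕ}
    (hK : ∀ (m : ℕ) (f : (Fin m → Bool) → Bool), HasDegF p f d →
      ∃ lam : Fin K → Fin m → ZMod p, ∃ F : (Fin K → ZMod p) → Bool, ∀ u, f u = F (fun j => ∑ i, if u i = true then lam j i else 0))
    (m : ℕ) : (degBool p m d).card ≤ (p ^ K * 2 ^ (p ^ K)) ^ (m + 1) := by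
  have hsub : degBool p m d ⊆ univ.image (ofPair (p := p) (m := m) (K := K)) := by
    intro f hf
    rw [degBool, mem_filter] at hf
    obtain ⟨lam, F, hF⟩ := hK m f hf.2
    rw [mem_image]
    exact ⟨(lam, F), mem_univ _, funext fun u => (hF u).symm⟩
  have hp0 : 0 < p := hp.out.pos
  calc (degBool p m d).card ≤ (univ.image (ofPair (p := p) (m := m) (K := K))).card := card_le_card hsub
    _ ≤ (univ : Finset ((Fin K → Fin m → ZMod p) × ((Fin K → ZMod p) → Bool))).card := card_image_le
    _ = (p ^ m) ^ K * 2 ^ (p ^ K) := by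
        simp only [card_univ, Fintype.card_prod, Fintype.card_fun, Fintype.card_fin, Fintype.card_bool, ZMod.card]
    _ = (p ^ K) ^ m * 2 ^ (p ^ K) := by rw [← pow_mul, ← pow_mul, mul_comm m K]
    _ ≤ (p ^ K) ^ (m + 1) * (2 ^ (p ^ K)) ^ (m + 1) :=
        Nat.mul_le_mul (Nat.pow_le_pow_right (by positivity) (Nat.le_succ m)) (Nat.le_self_pow (Nat.succ_ne_zero m) _)
    _ = (p ^ K * 2 ^ (p ^ K)) ^ (m + 1) := by rw [mul_pow]

/-- ★ B ⟹ EC (kernel): the structure law bounds the count by the number of pairs `(Λ, F)`. -/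
theorem expCount_of_structureLaw (hB : StructureLawTwoOdd) : ExpCountTwoOdd := by
  intro p _ hp5
  obtain ⟨K, hK⟩ := hB p hp5
  exact ⟨p ^ K * 2 ^ (p ^ K), fun m => card_degBool_le_of_forms hK m⟩

end BtoEC


/-! ## §4 EC ⟹ ORBIT BOUND (kernel) -/

section Orbit
variable {p : ℕ} [hp : Fact p.Prime]

/-- The orbit of a cut under the coordinate permutations `S_m` (as a finite set of cuts). -/
noncomputable def orbitS {m : ℕ} (f : (Fin m → Bool) → Bool) : Finset ((Fin m → Bool) → Bool) :=
  univ.image fun π : Equiv.Perm (Fin m) => fun u => f (u ∘ π)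

/-- The orbit of a degree-≤ d cut stays inside `B_d(m)`. -/
theorem orbitS_subset_degBool {m d : ℕ} {f : (Fin m → Bool) → Bool} (hf : HasDegF p f d) : orbitS f ⊆ degBool p m d := by
  intro g hg
  rw [orbitS, mem_image] at hg
  obtain ⟨π, _, rfl⟩ := hg
  rw [degBool, mem_filter]
  exact ⟨mem_univ _, Hegedus.comp_perm_mem_lowDeg π hf⟩

/-- ORBIT BOUND at degree `d` with base `C`: every degree-≤ d cut has `≤ C^{m+1}` distinct coordinate-permutes, i.e. its stabiliser in
`S_m` has index `≤ C^{m+1}`. -/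
def OrbitBoundAt (p : ℕ) [Fact p.Prime] (d C : ℕ) : Prop :=
  ∀ (m : ℕ) (f : (Fin m → Bool) → Bool), HasDegF p f d → (orbitS f).card ≤ C ^ (m + 1)

/-- ★ EC ⟹ ORBIT BOUND (kernel). -/
theorem orbitBound_of_expCount {d C : ℕ} (h : ExpCountAt p d C) : OrbitBoundAt p d C :=
  fun m _ hf => (card_le_card (orbitS_subset_degBool hf)).trans (h m)

end Orbit

/-! ### Axiom guards -/

/-- info: 'Summit.QuantumAdvantage.QuantumAdvantage.Theorems.CountDial.expCount_of_structureLaw' depends on axioms: [propext,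
 choice,
 Quot.sound] -/
#guard_msgs in #print axioms expCount_of_structureLaw

end Summit.QuantumAdvantage.QuantumAdvantage.Theorems.CountDial
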